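import Mathlib
import Summits.Ventures.PercRepro.TriangleCapAddEdges
import Summits.Ventures.PercRepro.TriangleCapDeepThreeWitness
import Summits.Ventures.PercRepro.TriangleCapSubBandMember

/-!
# PercRepro — THE "ELSE" BRANCH OF THE DEEP-BOTTOM CONJECTURE IS FALSE: A NON-BIPARTITE GRAPH OF THE BAND BELOW
`C(t,2) − t (D − 1) + r (D − r)` AT `ℓ = 6`, `t = 22`, `D = 4` (p3, gen 55; part 305)

The g54 conjecture (§10dp(c)) predicts, for `t > D²` and every `ℓ`, the bottom `C(t,2) − t (D − 1) + r (D − r)` of the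
deep sub-band `u = t − D` (`r = t mod D`) — `169` at `t = 22`, `D = 4`.  THE WITNESS: on `6 + 1 + (44 − 22) = 29`
vertices, the pair witness of part 226 with the `20` pairs of the rows `{1,2,3,6}`, `{1,2,3,6}`, `{1,2,4,5}`,
`{1,3,4,5}`, `{2,3,4,5}` (the leaves `7, …, 11`) and the star of `22` leaves at `0`, PLUS the two inside edges
`{6, 4}`, `{6, 5}` (part 304): triangle-free (the inside edges have no common row and form a path), `44` edges, `w = 0`
of degree `22`, every off-degree `≤ 4` (the non-neighbours `1, …, 6` all at `4`, the rows at `4`), and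
`Σ_v d(v)² = 722`, so the band value is `2 j = 44 · 45 − 722 − 2 · 22 · 21 = 334`: **`j = 167 < 169`**
(`else_branch_refuted`, `else_formula_not_lower_bound`).  The mechanism (part 301): `I = r = 2` inside edges make every
row full and cost `2 r + φ_D(2 r) = 4 < 2 r (D − r) = 8` — the residue bound is attained.  The graph is not bipartite
(`1 – 7 – 6 – 4 – 9 – 1` is a 5-cycle), as part 302 requires.  Axioms: standard.
-/

namespace PercRepro

namespace TriangleCap

namespace C047

open Finset

/-- The left ends of the `20` pairs: the rows `{1,2,3,6}`, `{1,2,3,6}`, `{1,2,4,5}`, `{1,3,4,5}`, `{2,3,4,5}`. -/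
def lfX (i : ℕ) : ℕ := [1, 2, 3, 6, 1, 2, 3, 6, 1, 2, 4, 5, 1, 3, 4, 5, 2, 3, 4, 5].getD i 0

/-- The right ends of the `20` pairs: the leaves `7, 8, 9, 10, 11`, four pairs each. -/
def rfX (i : ℕ) : ℕ := [7, 7, 7, 7, 8, 8, 8, 8, 9, 9, 9, 9, 10, 10, 10, 10, 11, 11, 11, 11].getD i 0

/-- `0 < 29`. -/
theorem h29 : 0 < 29 := by norm_num

/-- The bipartite part: the pair witness on `29` vertices, `a = 7`, `42` edges, `20` pairs. -/
abbrev H0X : SimpleGraph (Fin 29) := missingGraph (genWitness 29 7 42 20 h29 lfX rfX) (leftPart 29 7)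

/-- The two inside edges `{6, 4}` and `{6, 5}`. -/
abbrev SX : Finset (Sym2 (Fin 29)) := {s(fin' 29 h29 6, fin' 29 h29 4), s(fin' 29 h29 6, fin' 29 h29 5)}

/-- The witness: the pair witness plus the two inside edges. -/
abbrev HX : SimpleGraph (Fin 29) := addEdges H0X SX

/-- `fin' 29 a ≠ fin' 29 b` for `a ≠ b < 29`. -/
theorem fin'_ne (a b : ℕ) (ha : a < 29) (hb : b < 29) (hab : a ≠ b) : fin' 29 h29 a ≠ fin' 29 h29 b := by
  intro h
  have := congrArg Fin.val h
  rw [fin'_val 29 h29 a ha, fin'_val 29 h29 b hb] at this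
  exact hab this

/-- Membership of `fin' v` in the pair `s(fin' a, fin' b)` (`a, b, v < 29`): `v = a ∨ v = b`. -/
theorem mem_pair_iff (v a b : ℕ) (hv : v < 29) (ha : a < 29) (hb : b < 29) :
    fin' 29 h29 v ∈ s(fin' 29 h29 a, fin' 29 h29 b) ↔ v = a ∨ v = b := by
  rw [Sym2.mem_iff, Fin.ext_iff, Fin.ext_iff, fin'_val 29 h29 v hv, fin'_val 29 h29 a ha, fin'_val 29 h29 b hb]

/-- The two inside edges are distinct. -/
theorem SX_pair_ne : s(fin' 29 h29 6, fin' 29 h29 4) ≠ s(fin' 29 h29 6, fin' 29 h29 5) := by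
  intro h
  rw [Sym2.eq_iff] at h
  rcases h with ⟨-, h⟩ | ⟨h, -⟩
  · exact fin'_ne 4 5 (by norm_num) (by norm_num) (by norm_num) h
  · exact fin'_ne 6 5 (by norm_num) (by norm_num) (by norm_num) h

/-- `SX` has two elements. -/
theorem card_SX : SX.card = 2 := card_pair SX_pair_ne

/-- The bounds of the left ends. -/
theorem lfX_bounds : ∀ i, i < 20 → 1 ≤ lfX i ∧ lfX i < 7 := by
  unfold lfX
  decide

/-- The bounds of the right ends. -/
theorem rfX_bounds : ∀ i, i < 20 → 7 ≤ rfX i ∧ rfX i < 29 := by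
  unfold rfX
  decide

/-- The pairs are distinct. -/
theorem X_inj : ∀ i, i < 20 → ∀ i', i' < 20 → lfX i = lfX i' → rfX i = rfX i' → i = i' := by
  unfold lfX rfX
  decide

/-- The ends of the `20` pairs are good. -/
theorem goodEnds_X : GoodEnds 29 7 20 lfX rfX :=
  ⟨lfX_bounds, rfX_bounds, fun i i' hi hi' h1 h2 => X_inj i hi i' hi' h1 h2⟩

/-- No inside edge is diagonal. -/
theorem SX_nondiag : ∀ e ∈ SX, ¬ e.IsDiag := by
  intro e he
  simp only [SX, mem_insert, mem_singleton] at he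
  rcases he with rfl | rfl
  · rw [Sym2.mk_isDiag_iff]
    exact fin'_ne 6 4 (by norm_num) (by norm_num) (by norm_num)
  · rw [Sym2.mk_isDiag_iff]
    exact fin'_ne 6 5 (by norm_num) (by norm_num) (by norm_num)

/-- Every end of an inside edge is a non-neighbour `4`, `5` or `6`. -/
theorem SX_ends : ∀ e ∈ SX, ∀ x ∈ e, 4 ≤ x.val ∧ x.val < 7 := by
  intro e he x hx
  have hxv : x = fin' 29 h29 x.val := Fin.ext (by rw [fin'_val 29 h29 x.val x.isLt])
  rw [hxv] at hx
  simp only [SX, mem_insert, mem_singleton] at he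
  rcases he with rfl | rfl
  · rw [mem_pair_iff x.val 6 4 x.isLt (by norm_num) (by norm_num)] at hx
    omega
  · rw [mem_pair_iff x.val 6 5 x.isLt (by norm_num) (by norm_num)] at hx
    omega

/-- Every inside edge contains `6`. -/
theorem SX_six : ∀ e ∈ SX, fin' 29 h29 6 ∈ e := by
  intro e he
  simp only [SX, mem_insert, mem_singleton] at he
  rcases he with rfl | rfl
  · exact Sym2.mem_mk_left _ _
  · exact Sym2.mem_mk_left _ _

/-- `0` lies in no inside edge. -/
theorem SX_zero : ∀ e ∈ SX, fin' 29 h29 0 ∉ e := by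
  intro e he h
  have := SX_ends e he _ h
  rw [fin'_val 29 h29 0 (by norm_num)] at this
  omega

/-- No two pairs at the ends of an inside edge share a leaf: the inside edges have no common neighbour. -/
theorem SX_no_common : ∀ i, i < 20 → ∀ i', i' < 20 → ¬ (rfX i = rfX i' ∧
    ((lfX i = 6 ∧ lfX i' = 4) ∨ (lfX i = 4 ∧ lfX i' = 6) ∨ (lfX i = 6 ∧ lfX i' = 5) ∨ (lfX i = 5 ∧ lfX i' = 6))) := by
  unfold lfX rfX
  decide

/-- Two vertices of the left part are never adjacent in `H0X`. -/
theorem not_adj_H0X_left (x y : Fin 29) (hx : x.val < 7) (hy : y.val < 7) : ¬ H0X.Adj x y := by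
  intro h
  have hb := bipSub_missingGraph (genWitness 29 7 42 20 h29 lfX rfX) (leftPart 29 7) x y h
  simp only [leftPart, mem_filter, mem_univ, true_and] at hb
  exact (hb.mp hx) hy

/-- Adjacency of `0` with a vertex of the right part: always (the star has `22` leaves). -/
theorem adj_H0X_zero_right (y : Fin 29) (hy : 7 ≤ y.val) : H0X.Adj (fin' 29 h29 0) y := by
  rw [missingGraph_genWitness_adj 29 7 42 20 h29 lfX rfX (fin' 29 h29 0) y (by rw [fin'_val 29 h29 0 (by norm_num)]; norm_num) hy]
  left
  refine ⟨fin'_val 29 h29 0 (by norm_num), ?_⟩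
  have := y.isLt
  omega

/-- A non-zero vertex of the left part adjacent to a vertex of the right part in `H0X` is a pair end. -/
theorem adj_H0X_pair (x y : Fin 29) (hx1 : 1 ≤ x.val) (hx : x.val < 7) (hy : 7 ≤ y.val) (h : H0X.Adj x y) :
    ∃ i, i < 20 ∧ lfX i = x.val ∧ rfX i = y.val := by
  rw [missingGraph_genWitness_adj 29 7 42 20 h29 lfX rfX x y hx hy] at h
  rcases h with ⟨h0, -⟩ | h
  · omega
  · rw [mem_genPairs] at h
    obtain ⟨i, hi, he⟩ := h
    unfold genPair at he
    rw [Sym2.eq_iff] at he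
    have hl := (goodEnds_X.1 i hi)
    have hr := (goodEnds_X.2.1 i hi)
    rcases he with ⟨hx', hy'⟩ | ⟨hx', hy'⟩
    · refine ⟨i, hi, ?_, ?_⟩
      · rw [← hx', fin'_val 29 h29 _ (by omega)]
      · rw [← hy', fin'_val 29 h29 _ hr.2]
    · exfalso
      have := congrArg Fin.val hy'
      rw [fin'_val 29 h29 _ hr.2] at this
      omega

/-- No inside edge is an edge of `H0X`. -/
theorem SX_new : ∀ u v, s(u, v) ∈ SX → ¬ H0X.Adj u v := by
  intro u v h
  have hu := SX_ends _ h u (Sym2.mem_mk_left u v)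
  have hv := SX_ends _ h v (Sym2.mem_mk_right u v)
  exact not_adj_H0X_left u v hu.2 hv.2

/-- The inside edges form a triangle-free graph (there are only two). -/
theorem SX_triangle_free : ∀ a b c, s(a, b) ∈ SX → s(b, c) ∈ SX → s(a, c) ∈ SX → False := by
  intro a b c h1 h2 h3
  have hab : a ≠ b := fun h => SX_nondiag _ h1 (by rw [h]; exact Sym2.mk_isDiag_iff.mpr rfl)
  have hbc : b ≠ c := fun h => SX_nondiag _ h2 (by rw [h]; exact Sym2.mk_isDiag_iff.mpr rfl)
  have hac : a ≠ c := fun h => SX_nondiag _ h3 (by rw [h]; exact Sym2.mk_isDiag_iff.mpr rfl)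
  have h12 : s(a, b) ≠ s(b, c) := by
    intro h
    rw [Sym2.eq_iff] at h
    rcases h with ⟨h, -⟩ | ⟨h, -⟩
    · exact hab h
    · exact hac h
  have h13 : s(a, b) ≠ s(a, c) := by
    intro h
    rw [Sym2.eq_iff] at h
    rcases h with ⟨-, h⟩ | ⟨h, -⟩
    · exact hbc h
    · exact hac h
  have h23 : s(b, c) ≠ s(a, c) := by
    intro h
    rw [Sym2.eq_iff] at h
    rcases h with ⟨h, -⟩ | ⟨-, h⟩
    · exact hab h.symm
    · exact hac h.symm
  have hsub : ({s(a, b), s(b, c), s(a, c)} : Finset (Sym2 (Fin 29))) ⊆ SX := by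
    intro e he
    simp only [mem_insert, mem_singleton] at he
    rcases he with rfl | rfl | rfl
    · exact h1
    · exact h2
    · exact h3
  have hcard := card_le_card hsub
  rw [card_insert_of_notMem (by simp only [mem_insert, mem_singleton]; exact not_or.mpr ⟨h12, h13⟩),
    card_insert_of_notMem (by simp only [mem_singleton]; exact h23), card_singleton] at hcard
  have := card_SX
  omega

/-- No inside edge has a common neighbour in `H0X`. -/
theorem SX_no_common_nbr : ∀ a b c, s(a, b) ∈ SX → H0X.Adj a c → H0X.Adj b c → False := by
  intro a b c hS hac hbc
  have ha := SX_ends _ hS a (Sym2.mem_mk_left a b)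
  have hb := SX_ends _ hS b (Sym2.mem_mk_right a b)
  rcases Nat.lt_or_ge c.val 7 with hc | hc
  · exact not_adj_H0X_left a c ha.2 hc hac
  · obtain ⟨i, hi, hli, hri⟩ := adj_H0X_pair a c (by omega) ha.2 hc hac
    obtain ⟨i', hi', hli', hri'⟩ := adj_H0X_pair b c (by omega) hb.2 hc hbc
    -- the ends of the inside edge are `{6, 4}` or `{6, 5}`: one of them is `6`, they differ
    have h6 := SX_six _ hS
    rw [Sym2.mem_iff] at h6
    have hab6 : a.val = 6 ∨ b.val = 6 := by
      rcases h6 with h | h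
      · left
        rw [← h, fin'_val 29 h29 6 (by norm_num)]
      · right
        rw [← h, fin'_val 29 h29 6 (by norm_num)]
    have hne : a.val ≠ b.val := by
      intro h
      exact SX_nondiag _ hS (by rw [Sym2.mk_isDiag_iff]; exact Fin.ext h)
    exact SX_no_common i hi i' hi' ⟨by omega, by omega⟩

/-- No two inside edges at a vertex are closed by an edge of `H0X`. -/
theorem SX_no_mixed : ∀ a b c, s(a, b) ∈ SX → s(b, c) ∈ SX → H0X.Adj a c → False := by
  intro a b c h1 h2 hac
  have ha := SX_ends _ h1 a (Sym2.mem_mk_left a b)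
  have hc := SX_ends _ h2 c (Sym2.mem_mk_right b c)
  exact not_adj_H0X_left a c ha.2 hc.2 hac

/-- `HX` is triangle-free. -/
theorem cliqueFree_HX : HX.CliqueFree 3 :=
  cliqueFree_addEdges H0X SX (cliqueFree_of_bipSub _ _ (bipSub_missingGraph _ _)) SX_triangle_free
    SX_no_common_nbr SX_no_mixed

/-- `HX` has `44` edges. -/
theorem card_edges_HX : HX.edgeFinset.card = 44 := by
  rw [card_edgeFinset_addEdges H0X SX SX_nondiag SX_new,
    card_edges_missingGraph_genWitness 29 7 42 20 h29 lfX rfX goodEnds_X (by norm_num) (by norm_num) (by norm_num),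
    card_SX]

/-- `w = 0` has degree `22` in `HX`. -/
theorem deg_HX_zero : deg HX (fin' 29 h29 0) = 22 := by
  rw [deg_addEdges_of_notMem H0X SX _ SX_zero,
    deg_missingGraph_genWitness_zero 29 7 42 20 h29 lfX rfX goodEnds_X (by norm_num) (by norm_num)]

/-- The inside increment of the off-degree at a vertex `v`: `2` at `6`, `1` at `4` and `5`, `0` elsewhere. -/
def incX (v : ℕ) : ℕ := if v = 6 then 2 else if v = 4 ∨ v = 5 then 1 else 0

/-- The number of inside edges at the vertex `v` (`v < 29`). -/
theorem card_SX_filter (v : ℕ) (hv : v < 29) : (SX.filter (fun e => fin' 29 h29 v ∈ e)).card = incX v := by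
  have h1 := mem_pair_iff v 6 4 hv (by norm_num) (by norm_num)
  have h2 := mem_pair_iff v 6 5 hv (by norm_num) (by norm_num)
  rw [filter_insert, filter_singleton]
  unfold incX
  by_cases c1 : v = 6 ∨ v = 4 <;> by_cases c2 : v = 6 ∨ v = 5
  · rw [if_pos (h1.mpr c1), if_pos (h2.mpr c2),
      card_insert_of_notMem (by simp only [mem_singleton]; exact SX_pair_ne), card_singleton]
    split_ifs <;> omega
  · rw [if_pos (h1.mpr c1), if_neg (fun h => c2 (h2.mp h)), card_insert_of_notMem (notMem_empty _), card_empty]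
    split_ifs <;> omega
  · rw [if_neg (fun h => c1 (h1.mp h)), if_pos (h2.mpr c2), card_singleton]
    split_ifs <;> omega
  · rw [if_neg (fun h => c1 (h1.mp h)), if_neg (fun h => c2 (h2.mp h)), card_empty]
    split_ifs <;> omega

/-- The off-degree of `w = 0` at the vertex `v < 29`. -/
def offX (v : ℕ) : ℕ :=
  (if 1 ≤ v ∧ v < 7 then cls 20 lfX v + incX v else 0) + (if 7 ≤ v then cls 20 rfX v else 0)

/-- **THE OFF-DEGREES OF `HX`:** `offDeg HX 0 v = offX v`. -/
theorem offDeg_HX (v : ℕ) (hv : v < 29) : offDeg HX (fin' 29 h29 0) (fin' 29 h29 v) = offX v := by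
  rw [offDeg_addEdges H0X SX SX_nondiag SX_new _ SX_zero, card_SX_filter v hv]
  unfold offX
  rcases Nat.eq_zero_or_pos v with rfl | hv1
  · rw [offDeg_self]
    simp [incX]
  · by_cases hv7 : v < 7
    · rw [if_pos ⟨hv1, hv7⟩, if_neg (by omega)]
      rw [offDeg_genWitness_left 29 7 42 20 h29 lfX rfX goodEnds_X (by norm_num) v hv7]
      unfold cls
      omega
    · rw [if_neg (by omega), if_pos (by omega)]
      rw [offDeg_genWitness_right 29 7 42 20 h29 lfX rfX goodEnds_X (by norm_num) v (by omega) hv]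
      unfold cls
      have : incX v = 0 := by unfold incX; split_ifs <;> omega
      rw [this]
      omega

/-- Every off-degree of `HX` is at most `4`. -/
theorem offDeg_HX_le (v : Fin 29) : offDeg HX (fin' 29 h29 0) v ≤ 4 := by
  have hv : v = fin' 29 h29 v.val := Fin.ext (by rw [fin'_val 29 h29 v.val v.isLt])
  rw [hv, offDeg_HX v.val v.isLt]
  have := v.isLt
  have hall : ∀ v, v < 29 → offX v ≤ 4 := by
    unfold offX incX cls lfX rfX
    decide
  exact hall v.val this

/-- The non-neighbour `1` has off-degree `4`. -/
theorem offDeg_HX_one : offDeg HX (fin' 29 h29 0) (fin' 29 h29 1) = 4 := by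
  rw [offDeg_HX 1 (by norm_num)]
  unfold offX incX cls lfX rfX
  decide

/-- `1` is not adjacent to `0` in `HX`. -/
theorem not_adj_HX_one : ¬ HX.Adj (fin' 29 h29 0) (fin' 29 h29 1) := by
  rw [addEdges_adj_of_notMem H0X SX _ SX_zero]
  exact not_adj_genWitness_one 29 7 42 20 h29 lfX rfX (by norm_num) (by norm_num)

/-- The degree of the vertex `v < 29` in `HX`: `22` at `0`, the off-degree on the left, `1 +` the off-degree on the right. -/
def degX (v : ℕ) : ℕ := if v = 0 then 22 else if v < 7 then offX v else 1 + offX v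

/-- **THE DEGREES OF `HX`:** `deg HX v = degX v`. -/
theorem deg_HX (v : ℕ) (hv : v < 29) : deg HX (fin' 29 h29 v) = degX v := by
  unfold degX
  rcases Nat.eq_zero_or_pos v with rfl | hv1
  · rw [if_pos rfl]
    exact deg_HX_zero
  · rw [if_neg (by omega)]
    have hne : fin' 29 h29 v ≠ fin' 29 h29 0 := by
      intro h
      have := congrArg Fin.val h
      rw [fin'_val 29 h29 v hv, fin'_val 29 h29 0 (by norm_num)] at this
      omega
    have hd := deg_eq_boole_add_offDeg HX (fin' 29 h29 0) (fin' 29 h29 v) hne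
    rw [offDeg_HX v hv] at hd
    by_cases hv7 : v < 7
    · rw [if_pos hv7]
      have hna : ¬ HX.Adj (fin' 29 h29 0) (fin' 29 h29 v) := by
        rw [addEdges_adj_of_notMem H0X SX _ SX_zero]
        exact not_adj_H0X_left _ _ (by rw [fin'_val 29 h29 0 (by norm_num)]; norm_num)
          (by rw [fin'_val 29 h29 v hv]; exact hv7)
      rw [if_neg hna] at hd
      omega
    · rw [if_neg hv7]
      have ha : HX.Adj (fin' 29 h29 0) (fin' 29 h29 v) := by
        rw [addEdges_adj_of_notMem H0X SX _ SX_zero]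
        exact adj_H0X_zero_right _ (by rw [fin'_val 29 h29 v hv]; omega)
      rw [if_pos ha] at hd
      omega

/-- **THE SQUARE SUM OF `HX`:** `Σ_v d(v)² = 722`. -/
theorem sum_deg_sq_HX : ∑ v, deg HX v * deg HX v = 722 := by
  have h : ∀ v : Fin 29, deg HX v * deg HX v = degX v.val * degX v.val := by
    intro v
    have hv : v = fin' 29 h29 v.val := Fin.ext (by rw [fin'_val 29 h29 v.val v.isLt])
    rw [hv, deg_HX v.val v.isLt, fin'_val 29 h29 v.val v.isLt]
  rw [sum_congr rfl (fun v _ => h v), Fin.sum_univ_eq_sum_range (fun v => degX v * degX v) 29]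
  unfold degX offX incX cls lfX rfX
  decide

/-- **THE ELSE BRANCH IS REFUTED:** on `29 = 6 + 1 + (44 − 22)` vertices a triangle-free graph with `44` edges, a
vertex `w` of degree `22`, every off-degree `≤ 4`, a non-neighbour of off-degree exactly `4` (the sub-band `u = 18` of
`t = 22`, `D = 4`, `ℓ = 6`) and the band value `j = 167`. -/
theorem else_branch_refuted :
    ∃ (H : SimpleGraph (Fin 29)) (_ : DecidableRel H.Adj), H.CliqueFree 3 ∧
      H.edgeFinset.card = 44 ∧ ∃ w, deg H w + 22 = 44 ∧ (∀ v, offDeg H w v ≤ 4) ∧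
        (∃ x, ¬ H.Adj w x ∧ offDeg H w x = 4) ∧
        ∑ v, deg H v * deg H v + 2 * (22 * (44 - 22 - 1)) + 2 * 167 = 44 * (44 + 1) := by
  refine ⟨HX, inferInstance, cliqueFree_HX, card_edges_HX, fin' 29 h29 0, ?_, offDeg_HX_le,
    ⟨fin' 29 h29 1, not_adj_HX_one, offDeg_HX_one⟩, ?_⟩
  · rw [deg_HX_zero]
  · rw [sum_deg_sq_HX]

/-- The conjectured else-bottom `C(22,2) − 22 · 3 + 2 · 2 = 169` exceeds the attained value `167`. -/
theorem else_formula_not_lower_bound : 167 < Nat.choose 22 2 - 22 * (4 - 1) + (22 % 4) * (4 - 22 % 4) := by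
  decide

end C047

end TriangleCap

end PercRepro
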